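import Mathlib
import Summits.KontsevichZagierPeriods.Zeta5Search.CollinearityShift
import HarnessLib

/-!
# ζ(5) search — the normalised first digits of `𝒦_p(b)` and `V(b)` (regimes H0 and T), reduced to `ZMod p`
# (tools for gen-2 g9's `CollinearityCriterion` / `CollinearityCriterionT`, part 2 of 4)

Cell `pub-zeta5` (HONEST FRAMING: systematic search; no irrationality claim unless certified), typer seat generation 10.
Setting (REPORT-gen2-g9 §6.2 regime H0 and §9.1 regime T at once): `N ≥ 3`, every pole class strictly deeper than `−N` is single-pole
with `ν_x ≥ 0` (tame), and `S ⊆ [0,p)` is a set of SELECTED classes of exponent `−N` off which every exponent-`(−N)` pole class is again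
single-pole with `ν_x ≥ 0`.  With the NORMALISED sums `K̃ = (−p)^{N−3}·𝒦_p(b)` and `Ṽ = (−p)^{N}·V(b)`:

* §3 per class `x < p`: `‖(−p)^{N−3}𝒦_x − ĝ_x·[x ∈ S]σ_K(x)‖ ≤ p⁻¹` (U-K = `kDigit_holds` at a pole, the unit swapped to `ĝ_x` by G1;
  elsewhere Theorem A / the single-pole bound) and `‖(−p)^{N}V_x − ĝ_x·[x ∈ S]v̂_x‖ ≤ p⁻¹` (U-V = `vDigit_holds`; elsewhere `ν_x`);
* §4 hence `K̃`, `Ṽ` are `p`-integral with images `Σ_{x ∈ S} ḡ_x σ̄_K(x)` and `Σ_{x ∈ S} ḡ_x v̄_x` in `ZMod p` (`cast_kTilde`, `cast_vTilde`).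

`p`-adic digits of rational numbers; nothing here bears on irrationality.
-/

noncomputable section

open Finset

namespace Summit.KontsevichZagierPeriods.Zeta5Search.ClusterValuation

open Summit.KontsevichZagierPeriods.Zeta5Search.DualSeries (InBox)
open Summit.KontsevichZagierPeriods.Zeta5Search.WedgeDictionary (coeffV dOf)
open Summit.KontsevichZagierPeriods.Zeta5Search.CasoratianValuation (InPolytope shift)
open Summit.KontsevichZagierPeriods.Zeta5Search.BigPrime (shift_zero)
open Summit.KontsevichZagierPeriods.Zeta5Search.PadicSeries
open Summit.KontsevichZagierPeriods.Zeta5Search.LevelClass (padicNorm_vHat_le_one padicNorm_gHat_sub_le digit_swap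
  padicNorm_normalise)
open Summit.KontsevichZagierPeriods.Zeta5Search.CellA (small_add small_mul padicNorm_classRho_le_one)
open Literature.NumberTheory.Transcendental.BallRivoal (harm)

variable {p : ℕ} [hp : Fact p.Prime]
/-! ## §3  The normalised first digits of `𝒦_x` and `V_x`, class by class -/

/-- `‖ĉ_x‖ ≤ 1`. -/
theorem padicNorm_cHat_le_one (b : ℕ → ℤ) (h0 : 0 ≤ b 0) (hn : (b 0).toNat < p ^ 2) (hp2 : p ≠ 2) (x : ℕ) :
    padicNorm p (cHat b p x) ≤ 1 := by
  unfold cHat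
  refine padicNorm.sum_le' (fun q hq => ?_) zero_le_one
  have hqN : q ≤ (b 0).toNat := le_of_mem_classSet b (mem_filter.1 hq).1
  have hl : padicNorm p (((q / p : ℕ) : ℚ)) ≤ 1 := padicNorm.of_nat _
  refine (padicNorm.nonarchimedean (p := p)).trans (max_le ?_ ?_)
  · rw [padicNorm.mul, CellA.padicNorm_pow_eq]
    calc padicNorm p (((q / p : ℕ) : ℚ)) ^ 2 * padicNorm p (classRho b p q 1) ≤ 1 ^ 2 * 1 :=
          mul_le_mul (pow_le_pow_left₀ (padicNorm.nonneg _) hl 2) (padicNorm_classRho_le_one b h0 hqN hn hp2 1)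
            (padicNorm.nonneg _) (by positivity)
      _ = 1 := by ring
  · split_ifs
    · rw [padicNorm.mul, padicNorm.mul]
      have h2' : padicNorm p (2 : ℚ) ≤ 1 := by exact_mod_cast padicNorm.of_nat (p := p) 2
      calc padicNorm p 2 * padicNorm p (((q / p : ℕ) : ℚ)) * padicNorm p (classRho b p q 2) ≤ 1 * 1 * 1 :=
            mul_le_mul (mul_le_mul h2' hl (padicNorm.nonneg _) zero_le_one)
              (padicNorm_classRho_le_one b h0 hqN hn hp2 2) (padicNorm.nonneg _) (by positivity)
        _ = 1 := by ring
    · rw [padicNorm.zero]; exact zero_le_one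

/-- `‖σ_K(x)‖ ≤ 1`. -/
theorem padicNorm_sigmaK_le_one (b : ℕ → ℤ) (h0 : 0 ≤ b 0) (hn : (b 0).toNat < p ^ 2) (hp2 : p ≠ 2) (x : ℕ) :
    padicNorm p (sigmaK b p x) ≤ 1 := by
  unfold sigmaK
  split_ifs
  · exact padicNorm_cHat_le_one b h0 hn hp2 x
  · rw [padicNorm.zero]; exact zero_le_one

/-- `‖ĝ_x‖ ≤ 1` for every position `x` (by `cast_gHat`, `ĝ_x` is `p`-integral). -/
theorem padicNorm_gHat_le_one' (b : ℕ → ℤ) (hp5 : 5 ≤ p) (x : ℕ) : padicNorm p (gHat b p x) ≤ 1 :=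
  PInt.padicNorm_le_one (cast_gHat b hp5 x).1

omit hp in
/-- `σ_K(x) = 0` for a class with at most one pole. -/
theorem sigmaK_eq_zero_of_le_one (b : ℕ → ℤ) {x : ℕ} (h : classPoleCount b p x ≤ 1) : sigmaK b p x = 0 := by
  unfold sigmaK; rw [if_neg (by omega)]

omit hp in
/-- `v̂_x = 0` for a class without poles. -/
theorem vHat_eq_zero_of_noPole (b : ℕ → ℤ) {x : ℕ} (h0 : classPoleCount b p x = 0) : vHat b p x = 0 := by
  have he : classPoles b p x = ∅ := by
    rw [classPoleCount_eq_card_classPoles] at h0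
    exact card_eq_zero.1 h0
  unfold vHat
  rw [he, sum_empty]

section Digits

/-! The setting (regimes H0 and T of REPORT-gen2-g9 §6.2/§9.1 at once): `N ≥ 3`; every pole class strictly deeper than `−N` is a
single-pole class with `ν_x ≥ 0`; `S ⊆ [0,p)` is the set of SELECTED classes — all of class exponent `−N` — and a non-selected pole
class of exponent `−N` is again single-pole with `ν_x ≥ 0` (for `b` itself `S` = all deep classes; for `b + e_j` in regime T,
`S` = the unhit deep classes of `b`). -/

variable (b : ℕ → ℤ) (hb : InPolytope b) (hp5 : 5 ≤ p) (hwin : (b 0 + 2 : ℤ) < (p : ℤ) ^ 2)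
  {N : ℕ} (hN : 3 ≤ N)
  (hT : ∀ x, x < p → 1 ≤ classPoleCount b p x → classExp b p x < -(N : ℤ) →
    classPoleCount b p x = 1 ∧ 0 ≤ classNu b p x)
  (S : Finset ℕ) (hS : S ⊆ range p) (hsel : ∀ x ∈ S, classExp b p x = -(N : ℤ))
  (hnsel : ∀ x, x < p → x ∉ S → classExp b p x = -(N : ℤ) → 1 ≤ classPoleCount b p x →
    classPoleCount b p x = 1 ∧ 0 ≤ classNu b p x)
include hb hp5 hwin hN hT hsel hnsel

/-- **Normalised `𝒦`-digit**: `‖(−p)^{N−3}𝒦_x − ĝ_x·[x ∈ S]σ_K(x)‖ ≤ p⁻¹` for every `x < p`. -/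
theorem norm_kTilde_sub_le {x : ℕ} (hx : x < p) :
    padicNorm p ((-(p : ℚ)) ^ ((N : ℤ) - 3) * classK b p x -
      gHat b p x * (if x ∈ S then sigmaK b p x else 0)) ≤ (p : ℚ) ^ (-(1 : ℤ)) := by
  obtain ⟨hbox, -, -, hn⟩ := thmA_data b hb hwin
  have h0 : 0 ≤ b 0 := hbox.1
  have hprime := hp.out
  have hp2 : p ≠ 2 := by omega
  have hp' : (-(p : ℚ)) ≠ 0 := neg_ne_zero.2 (Nat.cast_ne_zero.2 hprime.ne_zero)
  have hp0 : (p : ℚ) ≠ 0 := Nat.cast_ne_zero.2 hprime.ne_zero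
  have hp1 : (1 : ℚ) ≤ p := one_le_p
  -- the single-pole bound, normalised
  have hsingle : classPoleCount b p x = 1 →
      padicNorm p ((-(p : ℚ)) ^ ((N : ℤ) - 3) * classK b p x) ≤ (p : ℚ) ^ (-(1 : ℤ)) := by
    intro h1
    rw [padicNorm.mul, LevelClass.padicNorm_neg_p_zpow]
    have hK := padicNorm_classK_le_single b hb hp5 hwin hx h1
    calc (p : ℚ) ^ (-((N : ℤ) - 3)) * padicNorm p (classK b p x)
        ≤ (p : ℚ) ^ (-((N : ℤ) - 3)) * (p : ℚ) ^ (-(1 : ℤ)) := mul_le_mul_of_nonneg_left hK (zpow_p_nonneg _)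
      _ ≤ 1 * (p : ℚ) ^ (-(1 : ℤ)) :=
        mul_le_mul_of_nonneg_right (zpow_le_one_of_nonpos₀ hp1 (by omega)) (zpow_p_nonneg _)
      _ = _ := one_mul _
  rcases Nat.eq_zero_or_pos (classPoleCount b p x) with hc0 | hpos
  · rw [classK_eq_zero_of_noPole b hb hc0, sigmaK_eq_zero_of_le_one b (by omega)]
    simp only [mul_zero, ite_self, sub_zero, padicNorm.zero]
    exact zpow_p_nonneg _
  by_cases hxS : x ∈ S
  · rw [if_pos hxS]
    have hE := hsel x hxS
    by_cases hmulti : 2 ≤ classPoleCount b p x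
    · -- selected multipole class: U-K at a pole, then swap the unit
      rw [show sigmaK b p x = cHat b p x by unfold sigmaK; rw [if_pos hmulti]]
      obtain ⟨q, hq⟩ := card_pos.1 (by unfold classPoleCount at hpos; omega :
        0 < ((classSet b p x).filter fun s => netExp b s < 0).card)
      obtain ⟨hqC, hqpole⟩ := mem_filter.1 hq
      have hxC : x ∈ classSet b p x := self_mem_classSet_of_classExp_neg b hx (by omega)
      have hD : padicNorm p (classK b p x - (-(p : ℚ)) ^ (classExp b p x + 1) * (p : ℚ) ^ 2 * gHat b p q * cHat b p x) ≤
          (p : ℚ) ^ (-((3 - (N : ℤ)) + 1)) := by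
        refine padicNorm_le_of_val fun hne => ?_
        have := kDigit_holds b p x q hb hprime hp5 hwin hx hqC hqpole (by omega) hne
        rw [hE] at this ⊢
        linarith
      have h1 : padicNorm p ((-(p : ℚ)) ^ ((N : ℤ) - 3) * classK b p x - gHat b p q * cHat b p x) ≤
          (p : ℚ) ^ (-(1 : ℤ)) := by
        have e1 : (-(p : ℚ)) ^ ((N : ℤ) - 3) * classK b p x - gHat b p q * cHat b p x =
            (-(p : ℚ)) ^ (-(3 - (N : ℤ))) *
              (classK b p x - (-(p : ℚ)) ^ (classExp b p x + 1) * (p : ℚ) ^ 2 * gHat b p q * cHat b p x) := by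
          rw [hE, mul_sub, show (-(3 - (N : ℤ))) = (N : ℤ) - 3 by ring]
          congr 1
          have e2 : (-(p : ℚ)) ^ ((N : ℤ) - 3) * (-(p : ℚ)) ^ (-(N : ℤ) + 1) * (p : ℚ) ^ 2 = 1 := by
            rw [← zpow_add₀ hp', show ((N : ℤ) - 3 + (-(N : ℤ) + 1)) = -2 by ring, zpow_neg, zpow_ofNat, neg_sq]
            field_simp
          calc gHat b p q * cHat b p x = ((-(p : ℚ)) ^ ((N : ℤ) - 3) * (-(p : ℚ)) ^ (-(N : ℤ) + 1) * (p : ℚ) ^ 2) *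
                (gHat b p q * cHat b p x) := by rw [e2, one_mul]
            _ = _ := by ring
        rw [e1]
        exact padicNorm_normalise hD
      exact digit_swap h1 (padicNorm_gHat_sub_le b hb hp5 hx hqC hxC) (padicNorm_cHat_le_one b h0 hn hp2 x)
    · -- selected single-pole class: `σ_K = 0`, `‖𝒦_x‖ ≤ p⁻¹`
      rw [sigmaK_eq_zero_of_le_one b (by omega), mul_zero, sub_zero]
      exact hsingle (by omega)
  · rw [if_neg hxS, mul_zero, sub_zero]
    rcases lt_trichotomy (classExp b p x) (-(N : ℤ)) with hlt | heq | hgt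
    · exact hsingle (hT x hx hpos hlt).1
    · exact hsingle (hnsel x hx hxS heq hpos).1
    · -- a pole class above the deep level: Theorem A
      rw [padicNorm.mul, LevelClass.padicNorm_neg_p_zpow]
      have hK := padicNorm_classK_le_multi b hb hp5 hwin hx hpos
      calc (p : ℚ) ^ (-((N : ℤ) - 3)) * padicNorm p (classK b p x)
          ≤ (p : ℚ) ^ (-((N : ℤ) - 3)) * (p : ℚ) ^ (-(3 + classExp b p x)) :=
            mul_le_mul_of_nonneg_left hK (zpow_p_nonneg _)
        _ = (p : ℚ) ^ (-((N : ℤ) + classExp b p x)) := by rw [← zpow_add₀ hp0]; ring_nf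
        _ ≤ _ := zpow_le_zpow_right₀ hp1 (by omega)

/-- **Normalised `V`-digit**: `‖(−p)^{N}V_x − ĝ_x·[x ∈ S]v̂_x‖ ≤ p⁻¹` for every `x < p`. -/
theorem norm_vTilde_sub_le {x : ℕ} (hx : x < p) :
    padicNorm p ((-(p : ℚ)) ^ (N : ℤ) * classV b p x -
      gHat b p x * (if x ∈ S then vHat b p x else 0)) ≤ (p : ℚ) ^ (-(1 : ℤ)) := by
  obtain ⟨hbox, -, -, hn⟩ := thmA_data b hb hwin
  have h0 : 0 ≤ b 0 := hbox.1
  have hprime := hp.out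
  have hp2 : p ≠ 2 := by omega
  have hp' : (-(p : ℚ)) ≠ 0 := neg_ne_zero.2 (Nat.cast_ne_zero.2 hprime.ne_zero)
  have hp0 : (p : ℚ) ≠ 0 := Nat.cast_ne_zero.2 hprime.ne_zero
  have hp1 : (1 : ℚ) ≤ p := one_le_p
  -- a pole class with `‖V_x‖ ≤ p^{−ν}`, `N + ν ≥ 1`, normalised
  have hbound : 1 ≤ classPoleCount b p x → 1 ≤ (N : ℤ) + classNu b p x →
      padicNorm p ((-(p : ℚ)) ^ (N : ℤ) * classV b p x) ≤ (p : ℚ) ^ (-(1 : ℤ)) := by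
    intro hpos hnu
    rw [padicNorm.mul, LevelClass.padicNorm_neg_p_zpow]
    have hV := padicNorm_classV_le b hb hp5 hwin hx hpos
    calc (p : ℚ) ^ (-(N : ℤ)) * padicNorm p (classV b p x)
        ≤ (p : ℚ) ^ (-(N : ℤ)) * (p : ℚ) ^ (-classNu b p x) := mul_le_mul_of_nonneg_left hV (zpow_p_nonneg _)
      _ = (p : ℚ) ^ (-((N : ℤ) + classNu b p x)) := by rw [← zpow_add₀ hp0]; ring_nf
      _ ≤ _ := zpow_le_zpow_right₀ hp1 (by omega)
  rcases Nat.eq_zero_or_pos (classPoleCount b p x) with hc0 | hpos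
  · rw [classV_eq_zero_of_noPole b hb hc0, vHat_eq_zero_of_noPole b hc0]
    simp only [mul_zero, ite_self, sub_zero, padicNorm.zero]
    exact zpow_p_nonneg _
  by_cases hxS : x ∈ S
  · rw [if_pos hxS]
    have hE := hsel x hxS
    obtain ⟨q, hq⟩ := card_pos.1 (by unfold classPoleCount at hpos; omega :
      0 < ((classSet b p x).filter fun s => netExp b s < 0).card)
    obtain ⟨hqC, hqpole⟩ := mem_filter.1 hq
    have hxC : x ∈ classSet b p x := self_mem_classSet_of_classExp_neg b hx (by omega)
    have hD : padicNorm p (classV b p x - (-(p : ℚ)) ^ (classExp b p x) * gHat b p q * vHat b p x) ≤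
        (p : ℚ) ^ (-((-(N : ℤ)) + 1)) := by
      refine padicNorm_le_of_val fun hne => ?_
      have := vDigit_holds b p x q hb hprime hp5 hwin hx hqC hqpole hne
      rw [hE] at this ⊢
      linarith
    have h1 : padicNorm p ((-(p : ℚ)) ^ (N : ℤ) * classV b p x - gHat b p q * vHat b p x) ≤ (p : ℚ) ^ (-(1 : ℤ)) := by
      have e1 : (-(p : ℚ)) ^ (N : ℤ) * classV b p x - gHat b p q * vHat b p x =
          (-(p : ℚ)) ^ (-(-(N : ℤ))) * (classV b p x - (-(p : ℚ)) ^ (classExp b p x) * gHat b p q * vHat b p x) := by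
        rw [hE, mul_sub, neg_neg]
        congr 1
        have e2 : (-(p : ℚ)) ^ (N : ℤ) * (-(p : ℚ)) ^ (-(N : ℤ)) = 1 := by
          rw [← zpow_add₀ hp', add_neg_cancel, zpow_zero]
        calc gHat b p q * vHat b p x = ((-(p : ℚ)) ^ (N : ℤ) * (-(p : ℚ)) ^ (-(N : ℤ))) * (gHat b p q * vHat b p x) := by
              rw [e2, one_mul]
          _ = _ := by ring
      rw [e1]
      exact padicNorm_normalise hD
    exact digit_swap h1 (padicNorm_gHat_sub_le b hb hp5 hx hqC hxC) (padicNorm_vHat_le_one b h0 hn hp2)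
  · rw [if_neg hxS, mul_zero, sub_zero]
    have hnuE := CellA.classExp_le_classNu b p x
    rcases lt_trichotomy (classExp b p x) (-(N : ℤ)) with hlt | heq | hgt
    · exact hbound hpos (by have := (hT x hx hpos hlt).2; omega)
    · exact hbound hpos (by have := (hnsel x hx hxS heq hpos).2; omega)
    · exact hbound hpos (by omega)

/-! ## §4  The normalised sums `K̃ = (−p)^{N−3}𝒦_p(b)` and `Ṽ = (−p)^N V(b)` in `ZMod p` -/

include hS in
/-- **`K̃` is `p`-integral with image `Σ_{x ∈ S} ḡ_x σ̄_K(x)`.** -/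
theorem cast_kTilde :
    ¬ p ∣ ((-(p : ℚ)) ^ ((N : ℤ) - 3) * kRes b p).den ∧
    ((((-(p : ℚ)) ^ ((N : ℤ) - 3) * kRes b p : ℚ)) : ZMod p) =
      ∑ x ∈ S, ((gHat b p x : ℚ) : ZMod p) * ((sigmaK b p x : ℚ) : ZMod p) := by
  obtain ⟨hbox, -, -, hn⟩ := thmA_data b hb hwin
  have h0 : 0 ≤ b 0 := hbox.1
  have hp2 : p ≠ 2 := by have := hp.out.two_le; omega
  rw [kRes_eq_sum_classK b hp.out.pos, mul_sum]
  -- termwise: `p`-integral with image `ḡ_x · [x ∈ S] σ̄_K(x)`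
  have hterm : ∀ x ∈ range p,
      ¬ p ∣ ((-(p : ℚ)) ^ ((N : ℤ) - 3) * classK b p x).den ∧
      ((((-(p : ℚ)) ^ ((N : ℤ) - 3) * classK b p x : ℚ)) : ZMod p) =
        ((gHat b p x : ℚ) : ZMod p) * (((if x ∈ S then sigmaK b p x else 0 : ℚ)) : ZMod p) := by
    intro x hx
    have hx' := mem_range.1 hx
    have hd := norm_kTilde_sub_le b hb hp5 hwin hN hT S hsel hnsel hx'
    have hs_den : ¬ p ∣ (if x ∈ S then sigmaK b p x else 0 : ℚ).den := by
      split_ifs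
      · exact PInt.of_padicNorm_le_one (padicNorm_sigmaK_le_one b h0 hn hp2 x)
      · exact PInt.zero
    have hs_norm : padicNorm p (gHat b p x * (if x ∈ S then sigmaK b p x else 0)) ≤ 1 := by
      rw [padicNorm.mul]
      refine mul_le_one₀ (padicNorm_gHat_le_one' b hp5 x) (padicNorm.nonneg _) ?_
      split_ifs
      · exact padicNorm_sigmaK_le_one b h0 hn hp2 x
      · rw [padicNorm.zero]; exact zero_le_one
    have hT_den := PInt.of_padicNorm_le_one (PInt.norm_le_one_of_near hs_norm hd)
    refine ⟨hT_den, ?_⟩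
    rw [PInt.cast_eq_of_norm_sub_le hT_den (PInt.mul (cast_gHat b hp5 x).1 hs_den) hd,
      PInt.cast_mul (cast_gHat b hp5 x).1 hs_den]
  refine ⟨PInt.sum fun x hx => (hterm x hx).1, ?_⟩
  rw [PInt.cast_sum fun x hx => (hterm x hx).1, sum_congr rfl fun x hx => (hterm x hx).2,
    ← sum_subset hS (fun x _ hxS => by rw [if_neg hxS, Rat.cast_zero, mul_zero])]
  exact sum_congr rfl fun x hxS => by rw [if_pos hxS]

include hS in
/-- **`Ṽ` is `p`-integral with image `Σ_{x ∈ S} ḡ_x v̄_x`.** -/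
theorem cast_vTilde :
    ¬ p ∣ ((-(p : ℚ)) ^ (N : ℤ) * coeffV b).den ∧
    ((((-(p : ℚ)) ^ (N : ℤ) * coeffV b : ℚ)) : ZMod p) =
      ∑ x ∈ S, ((gHat b p x : ℚ) : ZMod p) * ((vHat b p x : ℚ) : ZMod p) := by
  obtain ⟨hbox, -, -, hn⟩ := thmA_data b hb hwin
  have h0 : 0 ≤ b 0 := hbox.1
  have hp2 : p ≠ 2 := by have := hp.out.two_le; omega
  rw [coeffV_eq_sum_classV b hp.out.pos, mul_sum]
  have hterm : ∀ x ∈ range p,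
      ¬ p ∣ ((-(p : ℚ)) ^ (N : ℤ) * classV b p x).den ∧
      ((((-(p : ℚ)) ^ (N : ℤ) * classV b p x : ℚ)) : ZMod p) =
        ((gHat b p x : ℚ) : ZMod p) * (((if x ∈ S then vHat b p x else 0 : ℚ)) : ZMod p) := by
    intro x hx
    have hx' := mem_range.1 hx
    have hd := norm_vTilde_sub_le b hb hp5 hwin hN hT S hsel hnsel hx'
    have hs_den : ¬ p ∣ (if x ∈ S then vHat b p x else 0 : ℚ).den := by
      split_ifs
      · exact PInt.of_padicNorm_le_one (padicNorm_vHat_le_one b h0 hn hp2)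
      · exact PInt.zero
    have hs_norm : padicNorm p (gHat b p x * (if x ∈ S then vHat b p x else 0)) ≤ 1 := by
      rw [padicNorm.mul]
      refine mul_le_one₀ (padicNorm_gHat_le_one' b hp5 x) (padicNorm.nonneg _) ?_
      split_ifs
      · exact padicNorm_vHat_le_one b h0 hn hp2
      · rw [padicNorm.zero]; exact zero_le_one
    have hT_den := PInt.of_padicNorm_le_one (PInt.norm_le_one_of_near hs_norm hd)
    refine ⟨hT_den, ?_⟩
    rw [PInt.cast_eq_of_norm_sub_le hT_den (PInt.mul (cast_gHat b hp5 x).1 hs_den) hd,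
      PInt.cast_mul (cast_gHat b hp5 x).1 hs_den]
  refine ⟨PInt.sum fun x hx => (hterm x hx).1, ?_⟩
  rw [PInt.cast_sum fun x hx => (hterm x hx).1, sum_congr rfl fun x hx => (hterm x hx).2,
    ← sum_subset hS (fun x _ hxS => by rw [if_neg hxS, Rat.cast_zero, mul_zero])]
  exact sum_congr rfl fun x hxS => by rw [if_pos hxS]

end Digits

end Summit.KontsevichZagierPeriods.Zeta5Search.ClusterValuation

end
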